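import Literature.NumberTheory.Rogawski1990.LocalTransferAtOneHyperspecialLevelOne        -- ★ the tame waypoint (brings ★ junction `localTransferAtOne_of_populations`, ★ FILE B `isLocSmooth_indicator_ite_redMat`, (U), (P-L) tame)
import Literature.NumberTheory.Rogawski1990.DepthZeroKappaTransferTypeOneDyadic             -- ★ p853504 (this seat): the dyadic (P-1) clause
import Literature.NumberTheory.Rogawski1990.DepthZeroKappaTransferTypeTwoDyadic             -- ★ p853499 (this seat): the dyadic (P-2) clause
import Literature.NumberTheory.Rogawski1990.LevelOnePieceStrataConstancyAnyChar          -- ★ p853514 (LH10-p01 (g12)): (U)-dy `strataConstancy_of_levelOne_anyChar`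
import Literature.NumberTheory.Rogawski1990.DepthZeroKappaTransferLeviUnramifiedAll           -- ★ L4 (LH7-p04 (g13)): (P-L)-dy `depthZeroKappaTransfer_hyperspecial_levi_of_isUnramifiedIn`
import HarnessLib

/-!
# The Δ‴-transfer at the identity for `K`-class pieces of hyperspecial level ≤ 1 at EVERY unramified non-split place — the `v ∤ 2` hypothesis deleted
# (Rogawski 1990 §4.9, Langlands–Shelstad descent §2.1)

Topic `NumberTheory/Rogawski1990`; namespace `Literature.NumberTheory.Rogawski1990`.  THEOREMS ONLY (no definition, no instance, no notation, no named fact, no `sorry`).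
Cell `pub/hodgecm-mathlib` (D-0151), crux H413 = `stmt-HodgeConjecture-24833`, dyadic LEVEL-ONE waypoint of the half-A line LH4 (seat LH4-p01 (g11)).  HONEST LABEL:
HC_CM is proved only modulo the 2 remaining named inputs (hLiu418 24832, h413 24833) until rung 0 closes; this file is count-neutral support for H413 (it does not close
the crux, and it does not touch the level-two wall (L2-3)).

THE STATEMENT (`localTransferAtOne_of_hyperspecialLevel_le_one_of_isUnramifiedIn`) = ★ `localTransferAtOne_of_hyperspecialLevel_le_one`
(`LocalTransferAtOneHyperspecialLevelOne.lean` :61) with the ONE binder `(h2 : IsUnit (2 : 𝒪[w.1.adicCompletion L]))` DELETED and nothing else: `L` CM, `v` a finite place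
of `L⁺` UNRAMIFIED (`hv`) and NON-SPLIT in `L` (`w`, `hw`), ANY residue characteristic, `H′` hermitian with good reduction at `w` (`hH′w hH′i`), `μ` a unitary Hecke character
extending `ω_{L∕L⁺}` unramified at `w`; for every piece `g ∈ C_c^∞(G′_v)` supported in the hyperspecial `K`, `Ad K`-invariant and left-invariant under the level-1
congruence set, there are a neighbourhood `V` of `1 ∈ H_v` and `φH ∈ C_c^∞(H_v)` with `Φ^st(γH, φH) = Σ_c Δ(γH, c) Φ(c, g)` for every `G`-regular `γH ∈ V`.

THE PROOF = ★'s fold VERBATIM over the four 2-free populations: (U)-dy ★ `strataConstancy_of_levelOne_anyChar` (p853514, LH10-p01 (g12)); (P-1)-dy ★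
`depthZeroKappaTransfer_hyperspecial_typeOne_of_isUnramifiedIn` (p853504); (P-2)-dy ★ `depthZeroKappaTransfer_hyperspecial_typeTwo_of_isUnramifiedIn` (p853499);
(P-L)-dy ★ `depthZeroKappaTransfer_hyperspecial_levi_of_isUnramifiedIn` (LH7-p04 (g13)); junction ★ `localTransferAtOne_of_populations` with `ψ = ![χ₀, χ₁]`.

## References
* [Rogawski1990] J. D. Rogawski, *Automorphic Representations of Unitary Groups in Three Variables*, Ann. of Math. Stud. 123 (1990): §4.9 Prop. 4.9.1 (a)(b) p. 55; §8.1
  Props. 8.1.1–8.1.2 pp. 112–114; §4.3 (4.3.1) p. 43.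
* [LanglandsShelstad1990Descent] R. Langlands, D. Shelstad, *Descent for transfer factors*, The Grothendieck Festschrift II (1990): §2.1 (2.1.2).
-/

set_option autoImplicit false

noncomputable section

open MeasureTheory Measure Set Function NumberField IsDedekindDomain Matrix Polynomial Topology Filter
open Literature.NumberTheory.Automorphic Literature.NumberTheory.Automorphic.UnitaryGroup
open Literature.NumberTheory.Automorphic.IntegralReduction Literature.NumberTheory.GaloisRepresentations
open scoped Matrix MatrixGroups Classical ValuativeRel

namespace Literature.NumberTheory.Rogawski1990

/-! ## The waypoint head (dyadic) -/

/-- **THE LEVEL-ONE WAYPOINT AT EVERY UNRAMIFIED NON-SPLIT PLACE** = ★ `localTransferAtOne_of_hyperspecialLevel_le_one` with `h2` DELETED; fold of (U)-dy, (P-1)-dy ★ p853504,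
(P-2)-dy ★ p853499, (P-L)-dy over ★ `localTransferAtOne_of_populations`, verbatim. [cite: Rogawski1990, §4.9 Prop. 4.9.1 (a)(b) p. 55; §8.1 Props. 8.1.1–8.1.2 pp. 112–114; §4.3 (4.3.1) p. 43]
[cite: LanglandsShelstad1990Descent, §2.1 (2.1.2)] -/
theorem localTransferAtOne_of_hyperspecialLevel_le_one_of_isUnramifiedIn
    (L : Type) [Field L] [NumberField L] [IsCMField L] (H' : Matrix (Fin 3) (Fin 3) L) (μ : HeckeCharacter L)
    {v : HeightOneSpectrum (𝓞 ↥(maximalRealSubfield L))}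
    (hH' : (H'.map (cmConjRingHom L)).transpose = H') (w : PlacesOver L v)
    (hw : IsCMField.complexConj L • w.1 = w.1) (hv : Algebra.IsUnramifiedIn (𝓞 L) v.asIdeal)
    (hH'w : IsUnit (placeForm H' w.1)) (hH'i : hH'w.unit ∈ glInt 3 (w.1.adicCompletion L))
    (hμ : μ.IsUnramifiedAt w.1) (hμu : μ.IsUnitary)
    (hμω : ∀ x : ideleGroup ↥(maximalRealSubfield L), μ (AdeleRing.ideleBaseChange ↥(maximalRealSubfield L) L x) = quadraticHeckeCharCM L x)
    [MeasurableSpace ((cmDatum L 3 H').Local v)] [BorelSpace ((cmDatum L 3 H').Local v)]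
    [∀ γ : ((cmDatum L 3 H').Local v), MeasurableSpace (((cmDatum L 3 H').Local v) ⧸ Subgroup.centralizer ({γ} : Set ((cmDatum L 3 H').Local v)))]
    [∀ γ : ((cmDatum L 3 H').Local v), BorelSpace (((cmDatum L 3 H').Local v) ⧸ Subgroup.centralizer ({γ} : Set ((cmDatum L 3 H').Local v)))]
    [MeasurableSpace ((cmDatum L 2 (Matrix.of fun i j : Fin 2 => if i.val + j.val + 1 = 2 then (1 : L) else 0)).Local v × (cmDatum L 1 (Matrix.of fun i j : Fin 1 => if i.val + j.val + 1 = 1 then (1 : L) else 0)).Local v)] [BorelSpace ((cmDatum L 2 (Matrix.of fun i j : Fin 2 => if i.val + j.val + 1 = 2 then (1 : L) else 0)).Local v × (cmDatum L 1 (Matrix.of fun i j : Fin 1 => if i.val + j.val + 1 = 1 then (1 : L) else 0)).Local v)]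
  [∀ a : (cmDatum L 2 (Matrix.of fun i j : Fin 2 => if i.val + j.val + 1 = 2 then (1 : L) else 0)).Local v × (cmDatum L 1 (Matrix.of fun i j : Fin 1 => if i.val + j.val + 1 = 1 then (1 : L) else 0)).Local v, MeasurableSpace (((cmDatum L 2 (Matrix.of fun i j : Fin 2 => if i.val + j.val + 1 = 2 then (1 : L) else 0)).Local v × (cmDatum L 1 (Matrix.of fun i j : Fin 1 => if i.val + j.val + 1 = 1 then (1 : L) else 0)).Local v) ⧸ Subgroup.centralizer ({a} : Set ((cmDatum L 2 (Matrix.of fun i j : Fin 2 => if i.val + j.val + 1 = 2 then (1 : L) else 0)).Local v × (cmDatum L 1 (Matrix.of fun i j : Fin 1 => if i.val + j.val + 1 = 1 then (1 : L) else 0)).Local v)))]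
  [∀ a : (cmDatum L 2 (Matrix.of fun i j : Fin 2 => if i.val + j.val + 1 = 2 then (1 : L) else 0)).Local v × (cmDatum L 1 (Matrix.of fun i j : Fin 1 => if i.val + j.val + 1 = 1 then (1 : L) else 0)).Local v, BorelSpace (((cmDatum L 2 (Matrix.of fun i j : Fin 2 => if i.val + j.val + 1 = 2 then (1 : L) else 0)).Local v × (cmDatum L 1 (Matrix.of fun i j : Fin 1 => if i.val + j.val + 1 = 1 then (1 : L) else 0)).Local v) ⧸ Subgroup.centralizer ({a} : Set ((cmDatum L 2 (Matrix.of fun i j : Fin 2 => if i.val + j.val + 1 = 2 then (1 : L) else 0)).Local v × (cmDatum L 1 (Matrix.of fun i j : Fin 1 => if i.val + j.val + 1 = 1 then (1 : L) else 0)).Local v)))]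
    (νH : Measure ((cmDatum L 2 (Matrix.of fun i j : Fin 2 => if i.val + j.val + 1 = 2 then (1 : L) else 0)).Local v × (cmDatum L 1 (Matrix.of fun i j : Fin 1 => if i.val + j.val + 1 = 1 then (1 : L) else 0)).Local v)) [νH.IsHaarMeasure] [νH.IsMulRightInvariant]
    (νG : Measure ((cmDatum L 3 H').Local v)) [νG.IsHaarMeasure] [νG.IsMulRightInvariant]
    {mH : OrbitalMeasureFamily ((cmDatum L 2 (Matrix.of fun i j : Fin 2 => if i.val + j.val + 1 = 2 then (1 : L) else 0)).Local v × (cmDatum L 1 (Matrix.of fun i j : Fin 1 => if i.val + j.val + 1 = 1 then (1 : L) else 0)).Local v)} {mG : OrbitalMeasureFamily ((cmDatum L 3 H').Local v)}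
    (hmH : mH.IsCanonical (IsLocalGRegular L v) νH)
    (hmG : mG.IsCanonical (fun γ => IsRegularElt (γ.val : GL (Fin 3) (UnitaryGroup.LocalRing L v))) νG)
    -- the piece: `C_c^∞`, supported in the hyperspecial `K`, `Ad K`-invariant, left-invariant under the level-2 congruence set (A-69 (β), `j = 2`)
    (g : ((cmDatum L 3 H').Local v) → ℂ) (hg : IsLocSmooth g) (hgK : tsupport g ⊆ (cmLocalIntegralLevel L 3 H' v : Set ((cmDatum L 3 H').Local v)))
    (hginv : ∀ u ∈ cmLocalIntegralLevel L 3 H' v, ∀ x, g (u * x * u⁻¹) = g x)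
    (hg1 : ∀ u : (cmDatum L 3 H').Local v,
      (∀ a b, Valued.v (((toPlace v w (HeckeCharacter.uniformizer ↥(maximalRealSubfield L) v : v.adicCompletion ↥(maximalRealSubfield L))) ^ 1)⁻¹ *
        ((((localNonsplitEquiv (IsCMField.complexConj L) H' (IsCMField.complexConj_ne_one L) w hw u :
            ↥(unitaryGroupOfForm (galAdicCompletionMap (L := L) (IsCMField.complexConj L) hw) (placeForm H' w.1))) : GL (Fin 3) (w.1.adicCompletion L)) :
              Matrix (Fin 3) (Fin 3) (w.1.adicCompletion L)) a b - (1 : Matrix (Fin 3) (Fin 3) (w.1.adicCompletion L)) a b)) ≤ 1) →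
      ∀ x, g (u * x) = g x) :
    ∃ V ∈ 𝓝 (1 : ((cmDatum L 2 (Matrix.of fun i j : Fin 2 => if i.val + j.val + 1 = 2 then (1 : L) else 0)).Local v × (cmDatum L 1 (Matrix.of fun i j : Fin 1 => if i.val + j.val + 1 = 1 then (1 : L) else 0)).Local v)), ∃ φH : ((cmDatum L 2 (Matrix.of fun i j : Fin 2 => if i.val + j.val + 1 = 2 then (1 : L) else 0)).Local v × (cmDatum L 1 (Matrix.of fun i j : Fin 1 => if i.val + j.val + 1 = 1 then (1 : L) else 0)).Local v) → ℂ, IsLocSmooth φH ∧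
      ∀ γH ∈ V, IsLocalGRegular L v γH →
        stableOrbitalIntegralRel (IsLocalStablyConjH L v) mH φH γH =
          ∑ᶠ c : ConjClasses ((cmDatum L 3 H').Local v),
            ((finExplicitCollection L H' μ (finExplicitDelta_conj_left_all L H' μ) (finExplicitDelta_conj_right_all L H' μ)) v).Δ γH (Quotient.out c) *
              classOrbitalIntegral mG g c := by
  obtain ⟨c, hc⟩ := strataConstancy_of_levelOne_anyChar L H' hH' w hw hv hH'w hH'i g hginv hg1
  obtain ⟨V₁, hV₁, h₁⟩ := depthZeroKappaTransfer_hyperspecial_typeOne_of_isUnramifiedIn L H' μ hH' w hw hv hH'w hH'i hμ hμu hμω νH νG hmH hmG g hg hgK hginv c hc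
  obtain ⟨V₂, hV₂, h₂⟩ := depthZeroKappaTransfer_hyperspecial_typeTwo_of_isUnramifiedIn L H' μ hH' w hw hv hH'w hH'i hμ hμu hμω νH νG hmH hmG g hg hgK hginv c hc
  obtain ⟨V₃, hV₃, h₃⟩ := depthZeroKappaTransfer_hyperspecial_levi_of_isUnramifiedIn L H' μ hH' w hw hv hH'w hH'i hμ hμu hμω νH νG hmH hmG g hg hgK hginv c hc
  refine localTransferAtOne_of_populations L H' v w hmH.isAdmissibleOn _ mG g
    ![((((cmLocalIntegralLevel L 2 (Matrix.of fun i j : Fin 2 => if i.val + j.val + 1 = 2 then (1 : L) else 0) v).prod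
                (cmLocalIntegralLevel L 1 (Matrix.of fun i j : Fin 1 => if i.val + j.val + 1 = 1 then (1 : L) else 0) v) : Subgroup _) : Set _).indicator
              (fun h => if (redMat (((h.1.val : GL (Fin 2) (UnitaryGroup.LocalRing L v)).val.map (Pi.evalRingHom (fun w' : PlacesOver L v => w'.1.adicCompletion L) w))) - 1) ^ 2 = 0 ∧ (redMat (((h.1.val : GL (Fin 2) (UnitaryGroup.LocalRing L v)).val.map (Pi.evalRingHom (fun w' : PlacesOver L v => w'.1.adicCompletion L) w))) - 1).rank = 0 then (1 : ℂ) else 0)),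
      ((((cmLocalIntegralLevel L 2 (Matrix.of fun i j : Fin 2 => if i.val + j.val + 1 = 2 then (1 : L) else 0) v).prod
                (cmLocalIntegralLevel L 1 (Matrix.of fun i j : Fin 1 => if i.val + j.val + 1 = 1 then (1 : L) else 0) v) : Subgroup _) : Set _).indicator
              (fun h => if (redMat (((h.1.val : GL (Fin 2) (UnitaryGroup.LocalRing L v)).val.map (Pi.evalRingHom (fun w' : PlacesOver L v => w'.1.adicCompletion L) w))) - 1) ^ 2 = 0 ∧ (redMat (((h.1.val : GL (Fin 2) (UnitaryGroup.LocalRing L v)).val.map (Pi.evalRingHom (fun w' : PlacesOver L v => w'.1.adicCompletion L) w))) - 1).rank = 1 then (1 : ℂ) else 0))]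
    ?_ ![((νG.real (cmLocalIntegralLevel L 3 H' v : Set ((cmDatum L 3 H').Local v)) / νH.real (((cmLocalIntegralLevel L 2 (Matrix.of fun i j : Fin 2 => if i.val + j.val + 1 = 2 then (1 : L) else 0) v).prod
                (cmLocalIntegralLevel L 1 (Matrix.of fun i j : Fin 1 => if i.val + j.val + 1 = 1 then (1 : L) else 0) v) : Subgroup _) : Set _) : ℝ) : ℂ) * (((Ideal.absNorm v.asIdeal : ℂ) ^ 2)⁻¹ * c 0 + (((Ideal.absNorm v.asIdeal : ℂ) ^ 2 - 1) / (Ideal.absNorm v.asIdeal : ℂ) ^ 2) * c 1), ((νG.real (cmLocalIntegralLevel L 3 H' v : Set ((cmDatum L 3 H').Local v)) / νH.real (((cmLocalIntegralLevel L 2 (Matrix.of fun i j : Fin 2 => if i.val + j.val + 1 = 2 then (1 : L) else 0) v).prod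
                (cmLocalIntegralLevel L 1 (Matrix.of fun i j : Fin 1 => if i.val + j.val + 1 = 1 then (1 : L) else 0) v) : Subgroup _) : Set _) : ℝ) : ℂ) * (-((Ideal.absNorm v.asIdeal : ℂ))⁻¹ * c 1 + (((Ideal.absNorm v.asIdeal : ℂ) + 1) / (Ideal.absNorm v.asIdeal : ℂ)) * c 2)] ⟨V₁, hV₁, fun γH hγ hreg hS hL => (h₁ γH hγ hreg hS hL).trans ?_⟩ ⟨V₂, hV₂, fun γH hγ hreg hS => (h₂ γH hγ hreg hS).trans ?_⟩
      ⟨V₃, hV₃, fun γH hγ hreg hL => (h₃ γH hγ hreg hL).trans ?_⟩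
  · intro s
    fin_cases s
    · exact isLocSmooth_indicator_ite_redMat L v w hw 0 _
    · exact isLocSmooth_indicator_ite_redMat L v w hw 1 _
  all_goals simp only [Fin.sum_univ_two, Fin.isValue, Matrix.cons_val_zero, Matrix.cons_val_one]

end Literature.NumberTheory.Rogawski1990

end
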